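import Literature.Barriers.RiemannHypothesis.BestTrudgian2015
import Literature.NumberTheory.LFunctions.FejerProductMeans
import HarnessLib

/-!
# Best–Trudgian 2015, Theorem 2 for `M`: the frequency matching behind the Anderson–Stark weight

Barrier catalogue `Literature/Barriers/RiemannHypothesis/` (D-0021), support file for the entry
`MertensDisproof`; first of the two files discharging the named fact
`Literature.Barriers.RiemannHypothesis.BestTrudgian2015_thm2M` (`BestTrudgian2015.lean`: Best–Trudgian 2015, Theorem 2 —
Anderson–Stark — for `g = M` with the kernel of §3.2), the second being
`BestTrudgian2015Proofs.lean`.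

In the proof of Theorem 2 one averages the smoothed explicit formula
`∫ K(y−u) m(u) du = Re S(y) + o(1)`, `S(y) = Σ_{ρ : |γ| < T} a_ρ k(γ) e^{iγy}`, `a_ρ = (ρζ'(ρ))⁻¹`,
against the weight `Q(y) = Π_{γ ∈ Γ'} F_{N_γ}(γy + θ_γ)` (`AndersonStark.fejerProd`). By
`AndersonStark.tendsto_mean_fejerProd(_mul_re)` the means of `Q` and of `Q · Re S` are the sums of
the coefficients of the zero-frequency terms, i.e. over the `c ∈ Π[−N_γ, N_γ]` with
`Σ c_γ γ = 0`, resp. `Σ c_γ γ + γᵢ = 0`. This file identifies those terms from the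
`{N_γ}`-independence of `Γ'` in `Γ ∩ [0, T]` (Definition 1): by (2.4) only `c = 0` has frequency
`0`, so `M[Q] = 1` (`sum_freq_zero_eq_one`); by (2.5) the frequency `−γᵢ` of a zero
`ρᵢ = ½ + iγᵢ` is matched only by `c = −e_{γᵢ}` (`γᵢ ∈ Γ'`) and `+γᵢ` only by `c = e_{γᵢ}`, with
weights `N_γ/(N_γ+1) e^{∓iθ_γ}`, so that
`M[Q · S] = Σ_{γ ∈ Γ'} (N_γ/(N_γ+1)) (e^{−iθ_γ} b(½+iγ) + e^{iθ_γ} b(½−iγ))` (`sum_match_eq`).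
Under RH and simplicity every `γ ∈ Γ'` is the ordinate of the simple zeros `½ ± iγ`
(`half_add_mul_I_mem`, `half_sub_mul_I_mem`), and no zero has ordinate `0`
(`ζ(½) ≠ 0`, `im_ne_zero_of_mem`).

## References

* [BestTrudgian2015] §2, Definition 1 and Theorem 2 (after Anderson–Stark 1981), §2.1; read
  from arXiv:1209.3843.
-/

noncomputable section

open Complex Filter Finset
open Literature.NumberTheory.LFunctions Literature.NumberTheory.LFunctions.AndersonStark

namespace Literature.Barriers.RiemannHypothesis

namespace BestTrudgian2015

/-! ## The zeros below `T` under the zero clause -/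

/-- RH and the simplicity of the zeros give the zero clause of the kernel theorem at every
height: each zero of `ζ` in the critical strip has real part `½` and `ζ'(ρ) ≠ 0`.
[cite: BestTrudgian2015, §2.1] -/
theorem zeros_onLine_simple (hRH : RiemannHypothesis) (hS : SimpleZerosConjecture) :
    ∀ ρ : ℂ, riemannZeta ρ = 0 → 0 < ρ.re → ρ.re < 1 →
      ρ.re = 1 / 2 ∧ deriv riemannZeta ρ ≠ 0 := by
  intro ρ hζ h0 h1
  have hmem : ρ ∈ ZetaZeros.riemannZetaNontrivialZeros :=
    mem_riemannZetaNontrivialZeros_iff_holds.2 ⟨hζ, h0, h1⟩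
  refine ⟨hRH ρ hζ ?_ ?_, hS ρ hmem⟩
  · rintro ⟨n, hn⟩
    exact hmem.2 ⟨n, hn.symm⟩
  · rintro rfl
    exact riemannZeta_one_ne_zero hζ

variable {T : ℝ}

/-- A positive ordinate `γ < T` of a zero is, under the zero clause below `T`, the ordinate of the
zero `½ + iγ ∈ P`. [cite: BestTrudgian2015, §2.1] -/
theorem half_add_mul_I_mem
    (hz : ∀ ρ : ℂ, riemannZeta ρ = 0 → 0 < ρ.re → ρ.re < 1 → |ρ.im| < T →
      ρ.re = 1 / 2 ∧ deriv riemannZeta ρ ≠ 0)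
    {γ : ℝ} (hγ : γ ∈ zetaPositiveOrdinates) (hγT : γ < T) :
    (1 / 2 + γ * I : ℂ) ∈ (zetaZerosBelow_finite T).toFinset := by
  obtain ⟨hpos, σ, hζ⟩ := hγ
  have hmem : (σ + γ * I : ℂ) ∈ ZetaZeros.riemannZetaNontrivialZeros := by
    refine ⟨hζ, ?_⟩
    rintro ⟨n, hn⟩
    have := congrArg Complex.im hn
    simp at this
    exact hpos.ne' this.symm
  obtain ⟨-, h0, h1⟩ := mem_riemannZetaNontrivialZeros_iff_holds.1 hmem
  have habs : |(σ + γ * I : ℂ).im| < T := by simpa [abs_of_pos hpos] using hγT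
  obtain ⟨hre, -⟩ := hz _ hζ h0 h1 habs
  have hσ : σ = 1 / 2 := by simpa using hre
  subst hσ
  push_cast at hζ
  rw [mem_zetaZerosBelow_toFinset]
  refine ⟨hζ, by simp, by norm_num, by simpa [abs_of_pos hpos] using hγT⟩

/-- `conj (½ + iγ) = ½ − iγ`. [folklore] -/
theorem conj_half_add (γ : ℝ) : (starRingEnd ℂ) (1 / 2 + γ * I) = 1 / 2 - γ * I := by
  apply Complex.ext <;> simp

/-- … and so is `½ − iγ` (conjugate zeros). [cite: BestTrudgian2015, §2.1] -/
theorem half_sub_mul_I_mem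
    (hz : ∀ ρ : ℂ, riemannZeta ρ = 0 → 0 < ρ.re → ρ.re < 1 → |ρ.im| < T →
      ρ.re = 1 / 2 ∧ deriv riemannZeta ρ ≠ 0)
    {γ : ℝ} (hγ : γ ∈ zetaPositiveOrdinates) (hγT : γ < T) :
    (1 / 2 - γ * I : ℂ) ∈ (zetaZerosBelow_finite T).toFinset := by
  have h := half_add_mul_I_mem hz hγ hγT
  rw [mem_zetaZerosBelow_toFinset] at h ⊢
  obtain ⟨hζ, -, -, hT⟩ := h
  refine ⟨?_, by simp, by norm_num, by simpa using hT⟩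
  rw [← conj_half_add, riemannZeta_conj, hζ, map_zero]

/-- No zero of the index set has ordinate `0` (`ζ(σ) ≠ 0` for `0 < σ < 1`). [folklore] -/
theorem im_ne_zero_of_mem {ρ : ℂ} (hρ : ρ ∈ (zetaZerosBelow_finite T).toFinset) : ρ.im ≠ 0 := by
  rw [mem_zetaZerosBelow_toFinset] at hρ
  obtain ⟨hζ, h0, h1, -⟩ := hρ
  intro him
  have hρ : ρ = (ρ.re : ℂ) := Complex.ext (by simp) (by simp [him])
  rw [hρ] at hζ
  exact riemannZeta_ofReal_ne_zero_of_pos_of_lt_one ρ.re h0 h1 hζ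

/-- The absolute ordinate of a zero of the index set is a positive ordinate in `[0, T]`.
[cite: BestTrudgian2015, §2.1] -/
theorem abs_im_mem {ρ : ℂ} (hρ : ρ ∈ (zetaZerosBelow_finite T).toFinset) :
    |ρ.im| ∈ zetaPositiveOrdinates ∩ Set.Icc 0 T := by
  have him := im_ne_zero_of_mem hρ
  rw [mem_zetaZerosBelow_toFinset] at hρ
  obtain ⟨hζ, -, -, hT⟩ := hρ
  refine ⟨⟨abs_pos.2 him, ρ.re, ?_⟩, abs_nonneg _, hT.le⟩
  rcases lt_or_gt_of_ne him with h | h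
  · rw [abs_of_neg h]
    have : (ρ.re + ((-ρ.im : ℝ) : ℂ) * I : ℂ) = (starRingEnd ℂ) ρ := Complex.ext (by simp) (by simp)
    rw [this, riemannZeta_conj, hζ, map_zero]
  · rw [abs_of_pos h, Complex.re_add_im]
    exact hζ

/-! ## The matching -/

variable {Γ' : Finset ℝ} {N : ℝ → ℕ}

/-- `freq (−c) = −freq c`. [folklore] -/
theorem freq_neg {κ : Type*} [Fintype κ] (lam : κ → ℝ) (c : κ → ℤ) :
    freq lam (-c) = -freq lam c := by
  simp [freq, Finset.sum_neg_distrib]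

/-- The box is symmetric. [folklore] -/
theorem neg_mem_coeffBox {κ : Type*} [Fintype κ] [DecidableEq κ] {N : κ → ℕ} {c : κ → ℤ}
    (hc : c ∈ coeffBox N) : -c ∈ coeffBox N := by
  rw [mem_coeffBox] at hc ⊢
  simpa using hc

/-- `freq (e_{j₀}) = γ_{j₀}`. [folklore] -/
theorem freq_single (j₀ : ↥Γ') : freq ((fun j : ↥Γ' ↦ (j.1 : ℝ))) (Pi.single j₀ 1) = j₀.1 := by
  classical
  simp only [freq, Pi.single_apply, Int.cast_ite, Int.cast_one, Int.cast_zero, ite_mul,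
    one_mul, zero_mul, Finset.sum_ite_eq', Finset.mem_univ, if_true]

/-- `±e_{j₀}` lies in the box (`N ≥ 1` on `Γ'`). [folklore] -/
theorem single_mem_coeffBox (hN : ∀ γ ∈ Γ', 0 < N γ) (j₀ : ↥Γ') :
    (Pi.single j₀ 1 : ↥Γ' → ℤ) ∈ coeffBox ((fun j : ↥Γ' ↦ N j.1)) := by
  classical
  rw [mem_coeffBox]
  intro j
  by_cases h : j = j₀
  · subst h
    simp only [Pi.single_eq_same, abs_one, Nat.one_le_cast]
    exact hN j.1 j.2
  · simp [h]

/-- **(2.4) on the index type**: a coefficient vector in the box with frequency `0` vanishes.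
[cite: BestTrudgian2015, Definition 1 (2.4)] -/
theorem eq_zero_of_freq_eq_zero {Γ : Set ℝ} (hind : BestTrudgian.NIndependent Γ T Γ' N)
    {c : ↥Γ' → ℤ} (hc : c ∈ coeffBox ((fun j : ↥Γ' ↦ N j.1))) (h0 : freq ((fun j : ↥Γ' ↦ (j.1 : ℝ))) c = 0) : c = 0 := by
  classical
  set c' : ℝ → ℤ := fun x ↦ if h : x ∈ Γ' then c ⟨x, h⟩ else 0 with hc'
  have hbd : ∀ γ ∈ Γ', |c' γ| ≤ N γ := fun γ hγ ↦ by
    simp only [hc', hγ, dif_pos]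
    exact (mem_coeffBox.1 hc) ⟨γ, hγ⟩
  have hsum : ∑ γ ∈ Γ', (c' γ : ℝ) * γ = 0 := by
    rw [← h0, freq, ← Finset.sum_coe_sort]
    exact Finset.sum_congr rfl fun j _ ↦ by simp [hc', j.2]
  funext j
  have := hind.1 c' hbd hsum j.1 j.2
  simpa [hc', j.2] using this

/-- **(2.5) on the index type**: a coefficient vector in the box whose frequency is an element
`γ*` of `Γ ∩ [0, T]` is `e_{γ*}`, and `γ* ∈ Γ'`. [cite: BestTrudgian2015, Definition 1 (2.5)] -/
theorem eq_single_of_freq_eq {Γ : Set ℝ} (hind : BestTrudgian.NIndependent Γ T Γ' N) {γs : ℝ}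
    (hγs : γs ∈ Γ ∩ Set.Icc 0 T) {c : ↥Γ' → ℤ} (hc : c ∈ coeffBox ((fun j : ↥Γ' ↦ N j.1)))
    (h : freq ((fun j : ↥Γ' ↦ (j.1 : ℝ))) c = γs) : ∃ hs : γs ∈ Γ', c = Pi.single ⟨γs, hs⟩ 1 := by
  classical
  set c' : ℝ → ℤ := fun x ↦ if h : x ∈ Γ' then c ⟨x, h⟩ else 0 with hc'
  have hbd : ∀ γ ∈ Γ', |c' γ| ≤ N γ := fun γ hγ ↦ by
    simp only [hc', hγ, dif_pos]
    exact (mem_coeffBox.1 hc) ⟨γ, hγ⟩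
  have hsum : ∑ γ ∈ Γ', (c' γ : ℝ) * γ = γs := by
    rw [← h, freq, ← Finset.sum_coe_sort]
    exact Finset.sum_congr rfl fun j _ ↦ by simp [hc', j.2]
  obtain ⟨hmem, h1, hrest⟩ := hind.2 γs hγs c' hbd hsum
  refine ⟨hmem, funext fun j ↦ ?_⟩
  by_cases hj : j = ⟨γs, hmem⟩
  · subst hj
    simpa [hc', hmem] using h1
  · have hne : j.1 ≠ γs := fun h ↦ hj (Subtype.ext h)
    have := hrest j.1 j.2 hne
    simp only [hc', j.2, dif_pos] at this
    simp [hj, this]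

/-- **The matching set of a zero.** For `ρ ∈ P` the coefficient vectors `c` in the box with
`Σ c_γ γ + Im ρ = 0` are: `−e_{Im ρ}` if `Im ρ ∈ Γ'`, `e_{−Im ρ}` if `−Im ρ ∈ Γ'`, none otherwise.
[cite: BestTrudgian2015, Theorem 2 (proof) with Definition 1] -/
theorem filter_match_eq (hΓ' : ∀ γ ∈ Γ', 0 < γ) (hN : ∀ γ ∈ Γ', 0 < N γ)
    (hind : BestTrudgian.NIndependent zetaPositiveOrdinates T Γ' N) {ρ : ℂ} (hρ : ρ ∈ (zetaZerosBelow_finite T).toFinset) :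
    (coeffBox ((fun j : ↥Γ' ↦ N j.1))).filter (fun c ↦ freq ((fun j : ↥Γ' ↦ (j.1 : ℝ))) c + ρ.im = 0) =
      if h : ρ.im ∈ Γ' then {-Pi.single ⟨ρ.im, h⟩ 1}
      else if h' : -ρ.im ∈ Γ' then {Pi.single ⟨-ρ.im, h'⟩ 1} else ∅ := by
  classical
  have him := im_ne_zero_of_mem hρ
  have habs := abs_im_mem hρ
  ext c
  simp only [Finset.mem_filter]
  rcases lt_or_gt_of_ne him with hneg | hpos
  · -- `Im ρ < 0`: frequency `−Im ρ = |Im ρ|`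
    have h1 : ρ.im ∉ Γ' := fun h ↦ absurd (hΓ' _ h) hneg.not_gt
    rw [dif_neg h1]
    rw [abs_of_neg hneg] at habs
    constructor
    · rintro ⟨hc, hf⟩
      obtain ⟨hs, rfl⟩ := eq_single_of_freq_eq hind habs hc (by linarith)
      rw [dif_pos hs, Finset.mem_singleton]
    · intro hc
      by_cases h' : -ρ.im ∈ Γ'
      · rw [dif_pos h', Finset.mem_singleton] at hc
        subst hc
        exact ⟨single_mem_coeffBox hN _, by rw [freq_single]; ring⟩
      · rw [dif_neg h'] at hc
        simp at hc
  · -- `Im ρ > 0`: frequency `−Im ρ`, so `−c` has frequency `Im ρ`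
    have h2 : -ρ.im ∉ Γ' := fun h ↦ by linarith [hΓ' _ h]
    rw [abs_of_pos hpos] at habs
    constructor
    · rintro ⟨hc, hf⟩
      obtain ⟨hs, hcs⟩ := eq_single_of_freq_eq hind habs (neg_mem_coeffBox hc)
        (by rw [freq_neg]; linarith)
      rw [dif_pos hs, Finset.mem_singleton, ← hcs, neg_neg]
    · intro hc
      by_cases h : ρ.im ∈ Γ'
      · rw [dif_pos h, Finset.mem_singleton] at hc
        subst hc
        exact ⟨neg_mem_coeffBox (single_mem_coeffBox hN _), by rw [freq_neg, freq_single]; ring⟩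
      · rw [dif_neg h, dif_neg h2] at hc
        simp at hc

/-! ## The two mean values -/

/-- `fejerWeight N 0 = 1`, `fejerWeight N (±1) = N/(N+1)`. [folklore] -/
theorem fejerWeight_zero (N : ℕ) : fejerWeight N 0 = 1 := by simp [fejerWeight]

/-- `fejerWeight N 1 = N/(N+1)`. [folklore] -/
theorem fejerWeight_one (N : ℕ) : fejerWeight N 1 = N / (N + 1) := by
  rw [fejerWeight, Int.cast_one, abs_one]
  field_simp
  ring

/-- `fejerWeight` is even. [folklore] -/
theorem fejerWeight_neg (N : ℕ) (c : ℤ) : fejerWeight N (-c) = fejerWeight N c := by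
  simp [fejerWeight]

/-- `W_0 = 1`. [folklore] -/
theorem prodWeight_zero {κ : Type*} [Fintype κ] (N : κ → ℕ) (θ : κ → ℝ) : prodWeight N θ 0 = 1 := by
  simp [prodWeight, fejerWeight_zero]

/-- `W_{e_{j₀}} = (N_{j₀}/(N_{j₀}+1)) e^{iθ_{j₀}}`. [folklore] -/
theorem prodWeight_single (θ : ℝ → ℝ) (j₀ : ↥Γ') :
    prodWeight ((fun j : ↥Γ' ↦ N j.1)) ((fun j : ↥Γ' ↦ θ j.1)) (Pi.single j₀ 1) =
      ((N j₀.1 : ℂ) / (N j₀.1 + 1)) * cexp ((θ j₀.1 : ℂ) * I) := by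
  classical
  rw [prodWeight, Finset.prod_eq_single j₀, Finset.sum_eq_single j₀]
  · simp only [Pi.single_eq_same, Int.cast_one, one_mul, fejerWeight_one]
    push_cast
    rfl
  · intro j _ hj; simp [hj]
  · simp
  · intro j _ hj; simp [hj, fejerWeight_zero]
  · simp

/-- `W_{−e_{j₀}} = (N_{j₀}/(N_{j₀}+1)) e^{−iθ_{j₀}}`. [folklore] -/
theorem prodWeight_neg_single (θ : ℝ → ℝ) (j₀ : ↥Γ') :
    prodWeight ((fun j : ↥Γ' ↦ N j.1)) ((fun j : ↥Γ' ↦ θ j.1)) (-Pi.single j₀ 1) =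
      ((N j₀.1 : ℂ) / (N j₀.1 + 1)) * cexp (-((θ j₀.1 : ℂ) * I)) := by
  classical
  rw [prodWeight, Finset.prod_eq_single j₀, Finset.sum_eq_single j₀]
  · simp only [Pi.neg_apply, Pi.single_eq_same, Int.cast_neg, Int.cast_one, fejerWeight_neg,
      fejerWeight_one, neg_mul, one_mul, Complex.ofReal_neg]
    push_cast
    rfl
  · intro j _ hj; simp [hj]
  · simp
  · intro j _ hj; simp [hj, fejerWeight_zero]
  · simp

/-- **`M[Q] = 1`**: by (2.4) the only zero-frequency term of the weight is `c = 0`.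
[cite: BestTrudgian2015, Theorem 2 (proof)] -/
theorem sum_freq_zero_eq_one {Γ : Set ℝ} (hind : BestTrudgian.NIndependent Γ T Γ' N) (θ : ℝ → ℝ) :
    ∑ c ∈ coeffBox ((fun j : ↥Γ' ↦ N j.1)) with freq ((fun j : ↥Γ' ↦ (j.1 : ℝ))) c = 0, prodWeight ((fun j : ↥Γ' ↦ N j.1)) ((fun j : ↥Γ' ↦ θ j.1)) c = 1 := by
  classical
  have hset : (coeffBox ((fun j : ↥Γ' ↦ N j.1))).filter (fun c ↦ freq ((fun j : ↥Γ' ↦ (j.1 : ℝ))) c = 0) = {0} := by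
    ext c
    simp only [Finset.mem_filter, Finset.mem_singleton]
    constructor
    · rintro ⟨hc, h0⟩
      exact eq_zero_of_freq_eq_zero hind hc h0
    · rintro rfl
      exact ⟨mem_coeffBox.2 fun j ↦ by simp, by simp [freq]⟩
  rw [hset, Finset.sum_singleton, prodWeight_zero]

/-- **The matched sum**: by (2.5), for any `b`,
`Σ_{ρ ∈ P} Σ_{c : Σ c_γ γ + Im ρ = 0} W_c b(ρ) =
 Σ_{γ ∈ Γ'} (N_γ/(N_γ+1)) (e^{−iθ_γ} b(½ + iγ) + e^{iθ_γ} b(½ − iγ))` under the zero clause below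
`T`. [cite: BestTrudgian2015, Theorem 2 (proof)] -/
theorem sum_match_eq
    (hz : ∀ ρ : ℂ, riemannZeta ρ = 0 → 0 < ρ.re → ρ.re < 1 → |ρ.im| < T →
      ρ.re = 1 / 2 ∧ deriv riemannZeta ρ ≠ 0)
    (hΓ' : ↑Γ' ⊆ zetaPositiveOrdinates ∩ Set.Ioo 0 T) (hN : ∀ γ ∈ Γ', 0 < N γ)
    (hind : BestTrudgian.NIndependent zetaPositiveOrdinates T Γ' N) (θ : ℝ → ℝ) (b : ℂ → ℂ) :
    ∑ ρ ∈ (zetaZerosBelow_finite T).toFinset, ∑ c ∈ coeffBox ((fun j : ↥Γ' ↦ N j.1)) with freq ((fun j : ↥Γ' ↦ (j.1 : ℝ))) c + ρ.im = 0,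
        prodWeight ((fun j : ↥Γ' ↦ N j.1)) ((fun j : ↥Γ' ↦ θ j.1)) c * b ρ =
      ∑ γ ∈ Γ', ((N γ : ℂ) / (N γ + 1)) *
        (cexp (-((θ γ : ℂ) * I)) * b (1 / 2 + γ * I) + cexp ((θ γ : ℂ) * I) * b (1 / 2 - γ * I)) := by
  classical
  have hpos : ∀ γ ∈ Γ', 0 < γ := fun γ hγ ↦ (hΓ' hγ).2.1
  -- the inner sums
  have hinner : ∀ ρ ∈ (zetaZerosBelow_finite T).toFinset,
      ∑ c ∈ coeffBox ((fun j : ↥Γ' ↦ N j.1)) with freq ((fun j : ↥Γ' ↦ (j.1 : ℝ))) c + ρ.im = 0,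
          prodWeight ((fun j : ↥Γ' ↦ N j.1)) ((fun j : ↥Γ' ↦ θ j.1)) c * b ρ =
        (if ρ.im ∈ Γ' then ((N ρ.im : ℂ) / (N ρ.im + 1)) * cexp (-((θ ρ.im : ℂ) * I)) * b ρ else 0) +
        (if -ρ.im ∈ Γ' then ((N (-ρ.im) : ℂ) / (N (-ρ.im) + 1)) * cexp ((θ (-ρ.im) : ℂ) * I) * b ρ
          else 0) := by
    intro ρ hρ
    rw [filter_match_eq hpos hN hind hρ]
    by_cases h : ρ.im ∈ Γ'
    · have h' : -ρ.im ∉ Γ' := fun h' ↦ by linarith [hpos _ h, hpos _ h']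
      rw [dif_pos h, if_pos h, if_neg h', Finset.sum_singleton, prodWeight_neg_single, add_zero]
    · rw [dif_neg h, if_neg h, zero_add]
      by_cases h' : -ρ.im ∈ Γ'
      · rw [dif_pos h', if_pos h', Finset.sum_singleton, prodWeight_single]
      · rw [dif_neg h', if_neg h', Finset.sum_empty]
  rw [Finset.sum_congr rfl hinner, Finset.sum_add_distrib, ← Finset.sum_filter, ← Finset.sum_filter]
  -- reindex the two filtered sums by `γ ∈ Γ'`
  have hP : ∀ ρ ∈ (zetaZerosBelow_finite T).toFinset, ρ = 1 / 2 + ρ.im * I := fun ρ hρ ↦ (zetaZerosBelow_spec hz hρ).2.2.1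
  have himg₁ : ((zetaZerosBelow_finite T).toFinset).filter (fun ρ ↦ ρ.im ∈ Γ') = Γ'.image fun γ : ℝ ↦ (1 / 2 + γ * I : ℂ) := by
    ext ρ
    simp only [Finset.mem_filter, Finset.mem_image]
    constructor
    · rintro ⟨hρ, hΓ⟩
      exact ⟨ρ.im, hΓ, (hP ρ hρ).symm⟩
    · rintro ⟨γ, hγ, rfl⟩
      exact ⟨half_add_mul_I_mem hz (hΓ' hγ).1 (hΓ' hγ).2.2, by simpa using hγ⟩
  have himg₂ : ((zetaZerosBelow_finite T).toFinset).filter (fun ρ ↦ -ρ.im ∈ Γ') = Γ'.image fun γ : ℝ ↦ (1 / 2 - γ * I : ℂ) := by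
    ext ρ
    simp only [Finset.mem_filter, Finset.mem_image]
    constructor
    · rintro ⟨hρ, hΓ⟩
      refine ⟨-ρ.im, hΓ, ?_⟩
      rw [show (1 / 2 : ℂ) - ((-ρ.im : ℝ) : ℂ) * I = 1 / 2 + ρ.im * I by push_cast; ring]
      exact (hP ρ hρ).symm
    · rintro ⟨γ, hγ, rfl⟩
      exact ⟨half_sub_mul_I_mem hz (hΓ' hγ).1 (hΓ' hγ).2.2, by simpa using hγ⟩
  have hinj₁ : Set.InjOn (fun γ : ℝ ↦ (1 / 2 + γ * I : ℂ)) ↑Γ' := fun x _ y _ h ↦ by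
    simpa using congrArg Complex.im h
  have hinj₂ : Set.InjOn (fun γ : ℝ ↦ (1 / 2 - γ * I : ℂ)) ↑Γ' := fun x _ y _ h ↦ by
    simpa using congrArg Complex.im h
  rw [himg₁, himg₂, Finset.sum_image hinj₁, Finset.sum_image hinj₂, ← Finset.sum_add_distrib]
  refine Finset.sum_congr rfl fun γ _ ↦ ?_
  simp only [Complex.add_im, Complex.sub_im, Complex.mul_im, Complex.ofReal_re, Complex.I_im,
    Complex.ofReal_im, Complex.I_re, mul_one, mul_zero, add_zero, neg_sub]
  norm_num
  ring

end BestTrudgian2015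

end Literature.Barriers.RiemannHypothesis

end
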